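import Mathlib
import Literature.Analysis.Complex.PickFunctions
import Summits.CriticalPhenomena.CardyFormulaZ2.Statement
import Summits.CriticalPhenomena.CardyFormulaZ2.Theses.CardyPickBootstrap

/-!
# Strategist sketch — crux `PickLimit` (stmt-CriticalPhenomena-8390), route CardyPickBootstrap

Typed vocabulary for the STRATEGY-CENSUS of the redirect strategist (unit
cstrat-stmt-CriticalPhenomena-8390-r1): the route's inlined "sliding family / sublimit / Pick data"
blocks as named predicates (definitionally the route's text: `pickLimit_iff`), the TRANSFER form
`MatrixMonotoneLimit` (Loewner's language: sublimits are monotone matrix functions of all orders on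
`(0,1)`), the pure-analysis bridge `LoewnerBridge` (Loewner 1934 Part I + Nevanlinna + Stieltjes
inversion, differentiated), the rectangle-only strengthening vocabulary, and the PROVED assembly
`pickLimit_of_subs : MatrixMonotoneLimit → LoewnerBridge → PickLimit`.
Nothing here is filed as an item; see STRATEGY-CENSUS.md.
-/

namespace Summit.CriticalPhenomena.CardyFormulaZ2.Cruxes.PickLimit.Strategist

open Summit.CriticalPhenomena.CardyFormulaZ2.Theses.CardyPickBootstrap
open Literature.Probability.RandomPlanarGeometry Literature.Probability.Percolation
open Literature.Analysis.Complex MeasureTheory Filter Set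
open scoped ComplexOrder

/-- The route's inlined SLIDING-FAMILY hypothesis, verbatim: same Jordan domain and marks 0,1,2 for
all `η, η' ∈ (0,1)`, and every uniformizing datum of `Q η` has cross-ratio `η`. -/
def IsSlidingFamily (Q : ℝ → ConformalRectangle) : Prop :=
  (∀ η ∈ Set.Ioo (0:ℝ) 1, ∀ η' ∈ Set.Ioo (0:ℝ) 1,
      (Q η).toJordanDomain = (Q η').toJordanDomain ∧ (Q η).mark 0 = (Q η').mark 0 ∧
        (Q η).mark 1 = (Q η').mark 1 ∧ (Q η).mark 2 = (Q η').mark 2) ∧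
    (∀ η ∈ Set.Ioo (0:ℝ) 1,
      ∀ (φ : ConformalEquiv UpperHalfPlane.upperHalfPlaneSet (Q η).carrier) (x : Fin 4 → ℝ),
        (Q η).IsUniformizing φ x → crossRatio x = η)

/-- `p` is the pointwise limit on `(0,1)` of the bond-ℤ² crossing probabilities of the family `Q`
along the mesh sequence `δs → 0⁺` (the route's inlined SUBLIMIT hypothesis, verbatim). -/
def IsSublimit (Q : ℝ → ConformalRectangle) (δs : ℕ → ℝ) (p : ℝ → ℝ) : Prop :=
  (∀ k : ℕ, 0 < δs k) ∧ Tendsto δs atTop (nhds 0) ∧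
    ∀ η ∈ Set.Ioo (0:ℝ) 1,
      Tendsto (fun k : ℕ => bondDomainCrossingProb (Q η) (δs k)) atTop (nhds (p η))

/-- The conclusion of `PickLimit` for one function `p` (verbatim): differentiated Nevanlinna data
`(β, μ)` with `μ` carried by `ℝ ∖ (0,1)`. -/
def HasPickData (p : ℝ → ℝ) : Prop :=
  ∃ (β : ℝ) (μ : Measure ℝ), (0 ≤ β ∧ μ (Set.Ioo (0:ℝ) 1) = 0 ∧
    Integrable (fun t : ℝ => (1 + t ^ 2)⁻¹) μ ∧
      ∀ s ∈ Set.Ioo (0:ℝ) 1, HasDerivAt p (β + ∫ t, ((t - s) ^ 2)⁻¹ ∂μ) s)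

/-- `PickLimit` is, definitionally, "every sublimit of every sliding family has Pick data". -/
theorem pickLimit_iff :
    PickLimit ↔ ∀ Q, IsSlidingFamily Q → ∀ δs p, IsSublimit Q δs p → HasPickData p := by
  unfold PickLimit IsSlidingFamily IsSublimit HasPickData
  constructor
  · rintro h Q hQ δs p ⟨hpos, hδ, hp⟩
    exact h Q hQ δs hpos hδ p hp
  · intro h Q hQ δs hpos hδ p hp
    exact h Q hQ δs p ⟨hpos, hδ, hp⟩

/-! ## Transfer: Loewner's language -/

/-- TRANSFER FORM `C⁺` (Loewner's language): every sublimit of every sliding family is a monotone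
MATRIX function of all orders on `(0,1)` (`Literature.Analysis.Complex.IsMatrixMonotoneOn`, the
Rosenblum–Rovnyak notion via `cfc`). Equivalent to `PickLimit` modulo Loewner's theorem + the
Nevanlinna representation + Stieltjes inversion (`LoewnerBridge` below and its converse); it is the
derivative-free POSITIVITY face of the crux (all Loewner matrices PSD), closed under pointwise
limits, hence the form a lattice (finite-mesh, asymptotic) positivity statement can feed. -/
def MatrixMonotoneLimit : Prop :=
  ∀ Q, IsSlidingFamily Q → ∀ δs p, IsSublimit Q δs p → IsMatrixMonotoneOn p (Set.Ioo (0:ℝ) 1)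

/-- PURE-ANALYSIS BRIDGE (Loewner 1934 Part I ⇒ Pick continuation across `(0,1)`; Nevanlinna's
representation; Stieltjes inversion `μ((0,1)) = 0`; differentiation under the integral): a function
with values in `[0,1]` on `(0,1)` that is matrix monotone of all orders there has differentiated
Nevanlinna data. Classical and TRUE; in Lean it is conditional on / requires formalising the named
facts `loewner_theorem`, `nevanlinna_representation` and R–R App. §6 Thm C (not vendored). -/
def LoewnerBridge : Prop :=
  ∀ p : ℝ → ℝ, (∀ s ∈ Set.Ioo (0:ℝ) 1, p s ∈ Set.Icc (0:ℝ) 1) →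
    IsMatrixMonotoneOn p (Set.Ioo (0:ℝ) 1) → HasPickData p

/-- Sublimits of crossing probabilities take values in `[0,1]` on `(0,1)` (closedness of `Icc` and
`bondDomainCrossingProb_mem_Icc`). -/
theorem sublimit_mem_Icc {Q : ℝ → ConformalRectangle} {δs : ℕ → ℝ} {p : ℝ → ℝ}
    (h : IsSublimit Q δs p) : ∀ s ∈ Set.Ioo (0:ℝ) 1, p s ∈ Set.Icc (0:ℝ) 1 := by
  intro s hs
  obtain ⟨-, -, hp⟩ := h
  exact isClosed_Icc.mem_of_tendsto (hp s hs)
    (Filter.Eventually.of_forall fun k => bondDomainCrossingProb_mem_Icc _ _)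

/-- ASSEMBLY of the transfer / two-piece decomposition, PROVED:
`MatrixMonotoneLimit → LoewnerBridge → PickLimit`. -/
theorem pickLimit_of_subs (h₁ : MatrixMonotoneLimit) (h₂ : LoewnerBridge) : PickLimit := by
  rw [pickLimit_iff]
  intro Q hQ δs p hsub
  exact h₂ p (sublimit_mem_Icc hsub) (h₁ Q hQ δs p hsub)

/-! ## Closure of matrix monotonicity under pointwise limits (why the transfer has teeth) -/

/-- Matrix monotonicity on `Δ` is closed under pointwise convergence on `Δ` — no boundedness or
equicontinuity needed, because `cfc f A` only evaluates `f` on the finite spectrum of `A`.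
Stated as a `Prop` (the proof is `cfc`-bookkeeping: `cfc fₖ A → cfc f A` entrywise and the PSD cone
is closed); it is what reduces `MatrixMonotoneLimit` to an ASYMPTOTIC finite-mesh positivity law. -/
def MatrixMonotoneClosed : Prop :=
  ∀ (Δ : Set ℝ) (f : ℕ → ℝ → ℝ) (g : ℝ → ℝ), (∀ x ∈ Δ, Tendsto (fun k => f k x) atTop (nhds (g x))) →
    (∀ k, IsMatrixMonotoneOn (f k) Δ) → IsMatrixMonotoneOn g Δ

/-- LATTICE FACE (asymptotic Loewner positivity at finite mesh, the genuinely percolation-side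
content of the transfer): for a sliding family `Q`, Hermitian `A ≤ B` with spectra in `(0,1)` and
any mesh sequence, the Loewner defect of the finite-mesh crossing-probability function
`η ↦ bondDomainCrossingProb (Q η) (δs k)` is asymptotically nonnegative: every real cluster value of
`vᴴ (cfc P_δ B − cfc P_δ A) v` is `≥ 0`. (At FIXED mesh the function is a step function of `η` and
is NOT matrix monotone of order ≥ 2 — only the asymptotic form can hold.) -/
def AsymptoticLoewnerPositivity : Prop :=
  ∀ Q, IsSlidingFamily Q → ∀ (δs : ℕ → ℝ), (∀ k : ℕ, 0 < δs k) → Tendsto δs atTop (nhds 0) →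
    ∀ (n : ℕ) (A B : Matrix (Fin n) (Fin n) ℂ), A.IsHermitian → B.IsHermitian →
      spectrum ℝ A ⊆ Set.Ioo (0:ℝ) 1 → spectrum ℝ B ⊆ Set.Ioo (0:ℝ) 1 → (B - A).PosSemidef →
        ∀ v : Fin n → ℂ,
          0 ≤ Filter.liminf (fun k : ℕ => (star v ⬝ᵥ
            ((cfc (fun η : ℝ => bondDomainCrossingProb (Q η) (δs k)) B -
              cfc (fun η : ℝ => bondDomainCrossingProb (Q η) (δs k)) A).mulVec v)).re) atTop

/-! ## Transfer, sharper derivative-free form: Rosenblum–Rovnyak §2.12 Theorem A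

R–R 1985, §2.12 Thm A (book p. 36): a real measurable `f₀` on a Borel set `Δ` agrees a.e. on `Δ` with
some `f ∈ 𝒫` (Pick class) iff `lim_{ε↓0} ∬_{|s−t|>ε} [f₀(s)−f₀(t)]/(s−t) φ(s) φ̄(t) ds dt ≥ 0` whenever
`φ, f₀φ ∈ L²(Δ)`; Thm B (p. 37): for `C¹` `f₀` on an open `Δ` this is equivalent to analytic
continuation of `f ∈ 𝒫` across `Δ` agreeing with `f₀`, and to positivity of all Loewner matrices
(Loewner's theorem = the interval case). Theorem A's criterion is DERIVATIVE-FREE, makes sense for the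
finite-mesh step functions `η ↦ P_δ(η)`, and passes to bounded pointwise limits at fixed `ε`
(dominated convergence) — this is the lattice-facing form of the crux. -/

/-- Truncated Loewner-kernel quadratic form `∬_{(0,1)², |s−t|>ε} [f(s)−f(t)]/(s−t) φ(s) conj(φ(t)) ds dt`
(R–R (2-36) with `Δ = (0,1)`). -/
noncomputable def truncLoewnerForm (f : ℝ → ℝ) (φ : ℝ → ℂ) (ε : ℝ) : ℂ :=
  ∫ s in Set.Ioo (0:ℝ) 1, ∫ t in Set.Ioo (0:ℝ) 1,
    (if ε < |s - t| then (((f s - f t) / (s - t) : ℝ) : ℂ) * φ s * (starRingEnd ℂ) (φ t) else 0)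

/-- R–R Theorem A positivity for `f` on `(0,1)` against continuous test functions compactly supported
in `(0,1)`: `liminf_{ε↓0} Re ∬_{|s−t|>ε} … ≥ 0`, spelled out without `liminf` junk. -/
def PickKernelPositive (f : ℝ → ℝ) : Prop :=
  ∀ φ : ℝ → ℂ, Continuous φ → tsupport φ ⊆ Set.Ioo (0:ℝ) 1 → HasCompactSupport φ →
    ∀ η : ℝ, 0 < η → ∃ ε₀ : ℝ, 0 < ε₀ ∧ ∀ ε ∈ Set.Ioo (0:ℝ) ε₀, -η ≤ (truncLoewnerForm f φ ε).re

/-- TRANSFER FORM `C⁺_A`: every sublimit of every sliding family is Loewner-kernel positive on `(0,1)`. -/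
def KernelPositiveLimit : Prop :=
  ∀ Q, IsSlidingFamily Q → ∀ δs p, IsSublimit Q δs p → PickKernelPositive p

/-- PURE-ANALYSIS BRIDGE, Theorem-A form: a monotone `[0,1]`-valued kernel-positive function on
`(0,1)` has differentiated Nevanlinna data (R–R §2.12 Thm A ⇒ a.e. equal to a Pick trace `f`;
monotone + `f` continuous ⇒ equal everywhere on `(0,1)`; Thm B / App. §6 Thm B–C ⇒ `(β, μ)` with
`μ((0,1)) = 0`; differentiate). Classical, TRUE; not in Mathlib. -/
def LoewnerBridgeA : Prop :=
  ∀ p : ℝ → ℝ, (∀ s ∈ Set.Ioo (0:ℝ) 1, p s ∈ Set.Icc (0:ℝ) 1) → MonotoneOn p (Set.Ioo (0:ℝ) 1) →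
    PickKernelPositive p → HasPickData p

/-- LATTICE FACE, Theorem-A form (the genuinely percolation-side statement): asymptotic positivity,
as the mesh goes to `0`, of the truncated Loewner-kernel forms of the FINITE-MESH crossing
probability function `η ↦ P_{1/2}[(Q η) crossed at mesh δ_k]` of a sliding family — a
reflection-positivity-type inequality for a quadratic form in crossing probabilities over moduli
space (order of limits: `ε` outer, `k` inner, as Theorem A requires of the limit function). -/
def FiniteMeshKernelPositivity : Prop :=
  ∀ Q, IsSlidingFamily Q → ∀ (δs : ℕ → ℝ), (∀ k : ℕ, 0 < δs k) → Tendsto δs atTop (nhds 0) →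
    ∀ φ : ℝ → ℂ, Continuous φ → tsupport φ ⊆ Set.Ioo (0:ℝ) 1 → HasCompactSupport φ →
      ∀ η : ℝ, 0 < η → ∃ ε₀ : ℝ, 0 < ε₀ ∧ ∀ ε ∈ Set.Ioo (0:ℝ) ε₀, ∃ k₀ : ℕ, ∀ k ≥ k₀,
        -η ≤ (truncLoewnerForm (fun s => bondDomainCrossingProb (Q s) (δs k)) φ ε).re

/-- GLUE (dominated convergence at fixed `ε > 0`; provable now modulo measurability of the
finite-mesh functions, which are monotone step functions of `η`): finite-mesh kernel positivity
passes to every pointwise sublimit. -/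
def KernelPositiveLimit_of_finiteMesh : Prop :=
  FiniteMeshKernelPositivity →
    (∀ Q, IsSlidingFamily Q → ∀ δ : ℝ, 0 < δ → Measurable fun s => bondDomainCrossingProb (Q s) δ) →
      KernelPositiveLimit

/-- ASSEMBLY of the Theorem-A transfer, PROVED, using the route's existing support item
`APrioriShape` (stmt-CriticalPhenomena-8394) for monotonicity of sublimits:
`KernelPositiveLimit → LoewnerBridgeA → APrioriShape → PickLimit`. -/
theorem pickLimit_of_subsA (h₁ : KernelPositiveLimit) (h₂ : LoewnerBridgeA) (h₃ : APrioriShape) :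
    PickLimit := by
  rw [pickLimit_iff]
  intro Q hQ δs p hsub
  have hmono : MonotoneOn p (Set.Ioo (0:ℝ) 1) := by
    obtain ⟨hpos, hδ, hp⟩ := hsub
    exact (h₃ Q hQ δs hpos hδ p hp).2.1
  exact h₂ p (sublimit_mem_Icc hsub) hmono (h₁ Q hQ δs p hsub)

/-! ## Strengthen: the rectangle family and its exact finite-size face -/

/-- `PickLimit` restricted to the corner-marked RECTANGLE family (carrier `(0,r) × (0,1)`, marks at
the corners): the sub-statement for which an EXACT finite-size face `(P_m)` exists (strip transfer
matrices). It does NOT feed the route's `closes` (which needs every Jordan domain via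
`FamiliesExist`) without a conformal-transport input the route deliberately avoids. -/
def RectPickLimit : Prop :=
  ∀ Q, IsSlidingFamily Q →
    (∀ η ∈ Set.Ioo (0:ℝ) 1, ∃ r : ℝ, 0 < r ∧ (Q η).carrier = Set.Ioo (0:ℝ) r ×ℂ Set.Ioo (0:ℝ) 1 ∧
      (Q η).pt 0 = Complex.I ∧ (Q η).pt 1 = 0 ∧ (Q η).pt 2 = (r : ℂ) ∧ (Q η).pt 3 = (r : ℂ) + Complex.I) →
    ∀ δs p, IsSublimit Q δs p → HasPickData p

/-- The rectangle restriction is a WEAKENING of the crux (trivially). -/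
theorem rectPickLimit_of_pickLimit (h : PickLimit) : RectPickLimit := by
  rw [pickLimit_iff] at h
  intro Q hQ _ δs p hsub
  exact h Q hQ δs p hsub

end Summit.CriticalPhenomena.CardyFormulaZ2.Cruxes.PickLimit.Strategist
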